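import Literature.IUT.HodgeTheaters.TemperedCoveringsCharts
import Literature.IUT.HodgeTheaters.TemperedCoveringsCompletion
import Literature.AnabelianGeometry.SemiGraphs.TemperedResiduallyFiniteTransport
import Literature.GroupTheory.CombinatorialGroupTheory.VirtuallyFreeResiduallyFinite
import HarnessLib

/-!
# [IUTchI] Prop. 2.1 / Prop. 2.2 with every [SemiAnbd] input BY NAME (chart + profinite completion)

Mochizuki, *Inter-universal Teichmüller theory I*, kurims manuscript (May 2020), §2, Proposition 2.1
and Proposition 2.2, p. 45 [cite: Mochizuki2012, Prop 2.1 p.45] (D-0012 claim key; nothing of the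
series is asserted here).  PROOF-ONLY assembly (abc-iut-L5-t11) of `TemperedCoveringsCharts.lean`
(graph side BY NAME from a tempered fundamental group chart: [SemiAnbd] Thm 3.7 (i)/(iii), totally
elevated, Prop 3.6 (i)) and `TemperedCoveringsCompletion.lean` (completion side BY NAME from
`IsProfiniteCompletion`: Prop 3.6 (iii) / §6), plus abc-iut-L3's
`ProfiniteSemiGraph.exists_le_residuallyFinite_quotient` (proof of [SemiAnbd] Prop 3.6 (iii), p. 39:
the residually finite quotients are cofinal, GIVEN Galois domination with residually finite deck
groups), which turns the last completion-side hypothesis `hres` into L3's Galois-domination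
hypothesis BY NAME (`TemperedGraphGroupData.exists_residuallyFinite_quotient_of_chart`).

Main declarations: `TemperedGraphGroupData.prop21_of_chart_of_isProfiniteCompletion` ([IUTchI]
Prop 2.1 AS TYPED) and `TemperedGraphGroupData.tp_isCommensurablyTerminal_of_chart_of_isProfiniteCompletion`
([IUTchI] Prop 2.2, "in particular `Π^tp_𝔾` is commensurably terminal in `Π̂_𝔾`") for t1-data `D`
identified with (a chart `c` of `π₁^temp(𝒢)`, `e : D.Tp ≃ₜ* c.G`; `Π̂_𝔾` its profinite completion).
REMAINING hypotheses: L3's Galois-domination hypothesis (verbatim shape), the node data of the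
universal pro-covering in coset coordinates with (A3) = [NodNon] Lem 1.9 (ii) (typed as
`PSCDatum.VerticialIntersectionNear`, consumed in `TemperedCoveringsNodNon.lean`), and the
identification data.  Not a discharge of the node IUTchI:Prop2.1; typed ≠ discharged; nothing here
bears on [IUTchIII] Cor. 3.12.
-/

namespace Literature.IUT.HodgeTheaters

open Pointwise Filter
open _root_.Topology
open Literature.AnabelianGeometry.SemiGraphs (IsTempered IsProfiniteCompletion ProfiniteSemiGraph)
open Literature.AnabelianGeometry.SemiGraphs.ProfiniteSemiGraph (TemperedPiChart verticialSubgroups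
  CompactInVerticial VerticialInjective)
open Literature.AnabelianGeometry.AbsoluteAnabelian (IsCommensurablyTerminal)

universe u

/-! ### Everything BY NAME: chart + profinite completion + Galois domination -/

namespace TemperedGraphGroupData

variable (D : TemperedGraphGroupData.{u}) {𝒢 : ProfiniteSemiGraph.{u}}

/-- **`hres` BY NAME (modulo Galois domination).**  For `Π^tp_𝔾` identified with a chart `c` of
`π₁^temp(𝒢)`: if every connected tempered covering of `𝒢` is dominated by a Galois object with
residually finite automorphism group (the hypothesis of abc-iut-L3's
`ProfiniteSemiGraph.exists_le_residuallyFinite_quotient`, [SemiAnbd] proof of Prop 3.6 (iii) p. 39: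
"each `Gal(H'_i/G)` [an extension of a finite group by a free group] is residually finite"), then the
open normal `N ⊆ Π^tp_𝔾` with `Π^tp_𝔾/N` residually finite are cofinal.
[cite: MochizukiSemiAnbd2006, Prop 3.6(iii) p.39] -/
theorem exists_residuallyFinite_quotient_of_chart (c : TemperedPiChart 𝒢) (e : D.Tp ≃ₜ* c.G)
    (hGal : ∀ S : ProfiniteSemiGraph.BTempCat 𝒢, Literature.AlgebraicGeometry.Frobenioids.IsConnectedObj S →
      ∃ (H : ProfiniteSemiGraph.BTempCat 𝒢) (_ : H ⟶ S),
        Literature.AnabelianGeometry.SemiGraphs.IsGaloisObj H ∧ Group.ResiduallyFinite (CategoryTheory.Aut H)) :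
    ∀ V ∈ 𝓝 (1 : D.Tp), ∃ N : OpenNormalSubgroup D.Tp, (N : Set D.Tp) ⊆ V ∧
      Group.ResiduallyFinite (D.Tp ⧸ N.toSubgroup) := by
  intro V hV
  -- a basic open normal subgroup of `c.G` inside `e(V)`
  have hV' : (e.symm : c.G → D.Tp) ⁻¹' V ∈ 𝓝 (1 : c.G) := by
    apply e.symm.continuous.continuousAt.preimage_mem_nhds
    simpa using hV
  obtain ⟨N₀, -, hN₀⟩ := c.isTempered.basis _ hV'
  obtain ⟨N, hNle, hNrf⟩ := ProfiniteSemiGraph.exists_le_residuallyFinite_quotient 𝒢 c hGal N₀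
  haveI : N.toSubgroup.Normal := N.isNormal'
  let M : OpenNormalSubgroup D.Tp :=
    { toSubgroup := N.toSubgroup.comap (e : D.Tp →* c.G)
      isOpen' := N.isOpen'.preimage e.continuous
      isNormal' := Subgroup.Normal.comap inferInstance _ }
  refine ⟨M, fun x hx => ?_, ?_⟩
  · have hx' : e x ∈ (e.symm : c.G → D.Tp) ⁻¹' V := hN₀ (hNle hx)
    simpa using hx'
  · -- `D.Tp / M ≃* c.G / N`
    haveI := hNrf
    have hMN : (M.toSubgroup).map (e : D.Tp →* c.G) = N.toSubgroup :=
      Subgroup.map_comap_eq_self_of_surjective (by exact e.surjective) _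
    exact (Literature.GroupTheory.CombinatorialGroupTheory.residuallyFinite_congr
      (QuotientGroup.congr M.toSubgroup N.toSubgroup (e : D.Tp ≃* c.G) hMN)).mpr hNrf

/-- **[IUTchI] Proposition 2.1 AS TYPED, with every [SemiAnbd] input BY NAME** — for t1-data `D`
whose `Π^tp_𝔾 ↪ Π̂_𝔾` is identified with (a chart of) `π₁^temp(𝒢) ↪` its profinite completion
(`Σ̂ = 𝔓𝔯𝔦𝔪𝔢𝔰`): inputs `CompactInVerticial` (Thm 3.7 (iii)), the chart (Prop 3.6 (i)(ii)),
`IsProfiniteCompletion` (Prop 3.6 (iii) / §6), Galois domination with residually finite deck groups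
(proof of Prop 3.6 (iii), the hypothesis of L3's rung-2 theorem), a verticial family at the vertices
of `𝒢` (Thm 3.7 (i)); REMAINING: the node data of the universal pro-covering in coset coordinates and
(A3) = [NodNon] Lem 1.9 (ii) / [AbsTopII] Prop 1.3 (iv) (no tree name of that strength).
([IUTchI] Prop 2.1 p.45) [claim: Mochizuki2012, status: disputed] -/
theorem prop21_of_chart_of_isProfiniteCompletion (c : TemperedPiChart 𝒢) (e : D.Tp ≃ₜ* c.G)
    (h𝒢 : 𝒢.Thm37Hypotheses) (hCV : CompactInVerticial.{u})
    (hPC : IsProfiniteCompletion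
      ({ toMonoidHom := D.ι, continuous_toFun := D.ι_continuous } : D.Tp →ₜ* D.Hat))
    (hGal : ∀ S : ProfiniteSemiGraph.BTempCat 𝒢, Literature.AlgebraicGeometry.Frobenioids.IsConnectedObj S →
      ∃ (H : ProfiniteSemiGraph.BTempCat 𝒢) (_ : H ⟶ S),
        Literature.AnabelianGeometry.SemiGraphs.IsGaloisObj H ∧ Group.ResiduallyFinite (CategoryTheory.Aut H))
    (Λv : 𝒢.graph.Vertex → Subgroup D.Tp)
    (hΛv : ∀ v, (Λv v).map (e : D.Tp →* c.G) ∈ verticialSubgroups c v)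
    {E : Type*} (src tgt : E → 𝒢.graph.Vertex) (c₁ c₂ : E → D.Tp)
    (hA3 : ∀ (v w : 𝒢.graph.Vertex) (g h : D.Hat),
      MulAut.conj g • (Λv v).map D.ι ⊓ MulAut.conj h • (Λv w).map D.ι ≠ ⊥ →
        (v = w ∧ g⁻¹ * h ∈ (Λv v).map D.ι) ∨
        ∃ (e : E) (k : D.Hat), ∃ p ∈ (Λv (src e)).map D.ι, ∃ q ∈ (Λv (tgt e)).map D.ι,
          (src e = v ∧ tgt e = w ∧ g = k * D.ι (c₁ e) * p ∧ h = k * D.ι (c₂ e) * q) ∨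
          (src e = w ∧ tgt e = v ∧ h = k * D.ι (c₁ e) * p ∧ g = k * D.ι (c₂ e) * q)) :
    D.ProfiniteConjugatesOfCompactSubgroups :=
  D.prop21_of_cosetTree_of_isProfiniteCompletion (D.isTempered_tp_of_chart c e) hPC
    (D.exists_residuallyFinite_quotient_of_chart c e hGal) Λv src tgt c₁ c₂
    (fun Λ hΛc _ => D.conj_le_of_compactInVerticial c e h𝒢 hCV Λv hΛv Λ hΛc) hA3

/-- **[IUTchI] Proposition 2.2, "in particular, `Π^tp_𝔾` is commensurably terminal in `Π̂_𝔾`", with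
every [SemiAnbd] input BY NAME** (as `prop21_of_chart_of_isProfiniteCompletion`, plus
`VerticialInjective` (Thm 3.7 (i)) for the infinite compact verticial subgroup).
([IUTchI] Prop 2.2 p.45) [claim: Mochizuki2012, status: disputed] -/
theorem tp_isCommensurablyTerminal_of_chart_of_isProfiniteCompletion (c : TemperedPiChart 𝒢)
    (e : D.Tp ≃ₜ* c.G) (h𝒢 : 𝒢.Thm37Hypotheses) (hCV : CompactInVerticial.{u})
    (hVI : VerticialInjective.{u})
    (hPC : IsProfiniteCompletion
      ({ toMonoidHom := D.ι, continuous_toFun := D.ι_continuous } : D.Tp →ₜ* D.Hat))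
    (hGal : ∀ S : ProfiniteSemiGraph.BTempCat 𝒢, Literature.AlgebraicGeometry.Frobenioids.IsConnectedObj S →
      ∃ (H : ProfiniteSemiGraph.BTempCat 𝒢) (_ : H ⟶ S),
        Literature.AnabelianGeometry.SemiGraphs.IsGaloisObj H ∧ Group.ResiduallyFinite (CategoryTheory.Aut H))
    (Λv : 𝒢.graph.Vertex → Subgroup D.Tp)
    (hΛv : ∀ v, (Λv v).map (e : D.Tp →* c.G) ∈ verticialSubgroups c v)
    {E : Type*} (src tgt : E → 𝒢.graph.Vertex) (c₁ c₂ : E → D.Tp)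
    (hA3 : ∀ (v w : 𝒢.graph.Vertex) (g h : D.Hat),
      MulAut.conj g • (Λv v).map D.ι ⊓ MulAut.conj h • (Λv w).map D.ι ≠ ⊥ →
        (v = w ∧ g⁻¹ * h ∈ (Λv v).map D.ι) ∨
        ∃ (e : E) (k : D.Hat), ∃ p ∈ (Λv (src e)).map D.ι, ∃ q ∈ (Λv (tgt e)).map D.ι,
          (src e = v ∧ tgt e = w ∧ g = k * D.ι (c₁ e) * p ∧ h = k * D.ι (c₂ e) * q) ∨
          (src e = w ∧ tgt e = v ∧ h = k * D.ι (c₁ e) * p ∧ g = k * D.ι (c₂ e) * q)) :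
    IsCommensurablyTerminal D.ι.range := by
  obtain ⟨v₀, hv₀c, hv₀inf⟩ := D.exists_infinite_compact_of_chart c e h𝒢 hVI Λv hΛv
  exact D.tp_isCommensurablyTerminal_of_cosetTree_of_isProfiniteCompletion
    (D.isTempered_tp_of_chart c e) hPC (D.exists_residuallyFinite_quotient_of_chart c e hGal) Λv
    src tgt c₁ c₂ (fun Λ hΛc _ => D.conj_le_of_compactInVerticial c e h𝒢 hCV Λv hΛv Λ hΛc) hA3 v₀
    hv₀c hv₀inf

end TemperedGraphGroupData

end Literature.IUT.HodgeTheaters
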